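import Summits.BirchSwinnertonDyer.BirchSwinnertonDyer.Theorems.ManinLocalTwoThreeManinOddAtFourOfFourFacts
import Summits.BirchSwinnertonDyer.BirchSwinnertonDyer.Theorems.ManinLocalTwoThreeSL2OddPrimeStableCharacterExtension
import Summits.BirchSwinnertonDyer.BirchSwinnertonDyer.Theorems.ManinLocalTwoThreeNotTrivialEisensteinTwo
import Literature.NumberTheory.EllipticCurves.Gamma0AwayCharacterExtensionProofs
import HarnessLib

/-!
# E-es-22 `MultiShiftClassGenerationTwo` is a THEOREM; C2 `ManinOddAtFour` BY NAME from Kato's F♯ and the reducible residual alone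

Summit `BirchSwinnertonDyer`, route `ManinLocalTwoThree` (cell bsd-f2-manin), deciding crux C2 `ManinOddAtFour`
(stmt-BirchSwinnertonDyer-22967), line `kato_shift_two` (lead p1 gen 3; skeleton v9).  Of the four named inputs of
`ManinLocalTwoThreeManinOddAtFourOfFourFacts` (p611331), THREE are now tree theorems:

* F-es-27′ `sl2ZModOddPrime_existsUnique_extension_of_stable_character` — `Theorems.stub_sl2OddPrimeExtensionFact` (p2 g5, p612152);
* E-es-43 `gamma0Away_character_extension_of_shiftInvariant` — `Literature…gamma0Away_character_extension_of_shiftInvariant_holds`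
  (p3 g4, p614862: the abelianised Ihara–Serre amalgam by ping-pong);
* E-es-40 `NotTrivialEisensteinOfIrreducibleTwo` — `Theorems.stub_notTrivialEisensteinTwo` (lead, p615729: Chebotarev on `W[2]`,
  `W[2^{M+1}]` and `ζ_{t^{M+1}}`, Néron–Ogg–Shafarevich / Tate unipotence, total ramification of `ℚ(ζ_{t^m})`).

Consequences recorded here (one-line compositions, kernel-exact):

* **`multiShiftClassGenerationTwo_holds : MultiShiftClassGenerationTwo`** — the cell's candidate E-es-22 (`@[conjecture]` in
  `Rank1Residual/ManinAdditive/KatoShiftTwoLaws.lean`: the alternating multi-shift classes over admissible primes span an odd-index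
  subgroup of `Λ_f`) is a THEOREM, unconditionally;
* **`katoShiftTwistManinTwo_of_katoFact`** — E-es-21 `KatoShiftTwistManinTwo` from the ONE named Literature statement F♯
  `kato_neron_isIntegral_twistedSymbolSum_of_additive_two_real` (Kato, Astérisque 295, Thm. 6.6 (1) + 9.7 + 12.5, real-subfield reading;
  statement-only in the tree, size XL);
* **`maninOddAtFour_of_katoFact_of_orbitMinimalResidual`** — the ROUTE DECL `Theses.ManinLocalTwoThree.ManinOddAtFour` BY NAME from F♯
  and the ORBIT-MINIMAL `W[2]`-reducible residual (stub `stub_minimalReducibleResidual` of the line, verbatim) — exactly the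
  composition `ManinOddAtFour_of` of skeleton v9, whose only stubs are these two;
* **`maninOddAtFour_of_katoFact_of_reducible`** — the same from F♯ and the unrestricted residual `ManinOddOfReducibleAtFour`.

HONEST FRAMING: C2 is NOT closed — it is reduced to (i) one printed theorem of Kato not yet proved in the tree and (ii) Manin's
conjecture at `2` for optimal curves with a rational `2`-isogeny and `4 ∣ N` on the twist-orbit-minimal classes, which is OPEN
mathematics.  Nothing about BSD is proved by this file.  No new definitions; axioms standard.
-/

set_option autoImplicit false
set_option linter.dupNamespace false

noncomputable section

open scoped Classical MatrixGroups ModularForm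
open CongruenceSubgroup WeierstrassCurve Literature.NumberTheory.EllipticCurves
  Literature.NumberTheory.EllipticCurves.ModularForms
  Literature.NumberTheory.EllipticCurves.ModularForms.HidaCohomology
  Literature.GroupTheory.SpecificGroups
  Summit.BirchSwinnertonDyer.Rank1Residual.ManinAdditive

namespace Summit.BirchSwinnertonDyer.BirchSwinnertonDyer.Theorems.ManinLocalTwoThree

/-- **E-es-22 `MultiShiftClassGenerationTwo` holds** (odd-index generation of `Λ_f` by the alternating multi-shift classes over
admissible primes), from the three proved inputs F-es-27′ (p612152), E-es-43 (p614862), E-es-40 (p615729) through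
`multiShiftClassGenerationTwo_of_threeFacts` (p611331: E-es-37 descent p607037/p608494, the `C₃`-residual chain, E-es-40₂ p610460).
[cite: SerreTrees1980, Ch. I §4.1 Thm. 6, Ch. II §1.4 Thm. 3] -/
theorem multiShiftClassGenerationTwo_holds : MultiShiftClassGenerationTwo :=
  multiShiftClassGenerationTwo_of_threeFacts
    Summit.BirchSwinnertonDyer.BirchSwinnertonDyer.Theorems.stub_sl2OddPrimeExtensionFact
    Literature.NumberTheory.EllipticCurves.gamma0Away_character_extension_of_shiftInvariant_holds
    Summit.BirchSwinnertonDyer.BirchSwinnertonDyer.Theorems.stub_notTrivialEisensteinTwo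

/-- **E-es-21 `KatoShiftTwistManinTwo` from Kato's F♯ alone.** CONDITIONAL on the named Literature statement F♯.
[cite: Kato2004Asterisque, Thm. 9.7 (p. 189)] -/
theorem katoShiftTwistManinTwo_of_katoFact
    (hF : kato_neron_isIntegral_twistedSymbolSum_of_additive_two_real) : KatoShiftTwistManinTwo :=
  katoShiftTwistManinTwo_of_realKatoFact_of_generation hF multiShiftClassGenerationTwo_holds

/-- **C2 `ManinOddAtFour` BY NAME from Kato's F♯ and the ORBIT-MINIMAL `W[2]`-reducible residual** (the two stubs of skeleton v9 of
line `kato_shift_two`, verbatim).  CONDITIONAL result; the reducible residual is open mathematics.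
[cite: Kato2004Asterisque, Thm. 9.7 (p. 189)] -/
theorem maninOddAtFour_of_katoFact_of_orbitMinimalResidual
    (hF : kato_neron_isIntegral_twistedSymbolSum_of_additive_two_real)
    (hRb : ∀ (W : WeierstrassCurve ℚ) [W.IsElliptic] [W.IsGloballyMinimal] {N : ℕ} [NeZero N]
      (D : ModularParametrizationData W N),
      (∀ z ∈ D.L.lattice, ∃ w ∈ periodLattice D.f, z = D.c * w) → 2 ^ 2 ∣ N →
      ¬ (∃ (W' : WeierstrassCurve ℚ) (d : ℤ), W'.IsElliptic ∧ W'.IsGloballyMinimal ∧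
        (d = -1 ∨ d = 2 ∨ d = -2) ∧ IsIsogenous W (W'.quadraticTwist (d : ℚ)) ∧
        ¬ 2 ^ 2 ∣ W'.conductorNorm ℤ) →
      ¬ (∃ (W' : WeierstrassCurve ℚ) (q : ℕ), W'.IsElliptic ∧ W'.IsGloballyMinimal ∧
        q.Prime ∧ q ≠ 2 ∧ q ^ 2 ∣ N ∧
        IsIsogenous W (W'.quadraticTwist (((-1 : ℤ) ^ (q / 2) * q : ℤ) : ℚ)) ∧
        ¬ q ^ 2 ∣ W'.conductorNorm ℤ) →
      ¬ (∃ (A : WeierstrassCurve ℚ), A.IsElliptic ∧ A.IsGloballyMinimal ∧ 2 ^ 4 ∣ N ∧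
        2 ^ 2 ∣ A.conductorNorm ℤ ∧ A.conductorNorm ℤ ∣ N ∧ A.conductorNorm ℤ < N ∧
        IsIsogenous W (A.quadraticTwist ((-1 : ℤ) : ℚ))) →
      ¬ (∃ (A : WeierstrassCurve ℚ) (_ : A.IsElliptic) (_ : A.IsGloballyMinimal) (N' : ℕ) (_ : NeZero N')
        (D' : ModularParametrizationData A N') (d : ℤ) (C : WeierstrassCurve ℚ) (u : VariableChange ℚ),
        C.IsElliptic ∧ C.IsGloballyMinimal ∧
        (∀ z ∈ D'.L.lattice, ∃ w ∈ periodLattice D'.f, z = D'.c * w) ∧ (d = 2 ∨ d = -2) ∧ 2 ^ 6 ∣ N ∧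
        2 ^ 2 ∣ A.conductorNorm ℤ ∧ A.conductorNorm ℤ ∣ N ∧
        IsIsogenous W (A.quadraticTwist (d : ℚ)) ∧ u • A.quadraticTwist (d : ℚ) = C ∧
        C.Δ = (d : ℚ) ^ 6 * A.Δ ∧
        (A.conductorNorm ℤ < N ∨ A.minimalDiscriminantInt.natAbs < W.minimalDiscriminantInt.natAbs)) →
      ¬ (∃ (A : WeierstrassCurve ℚ) (_ : A.IsElliptic) (_ : A.IsGloballyMinimal)
        (D' : ModularParametrizationData A N) (q : ℕ) (C : WeierstrassCurve ℚ) (u : VariableChange ℚ),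
        C.IsElliptic ∧ C.IsGloballyMinimal ∧
        (∀ z ∈ D'.L.lattice, ∃ w ∈ periodLattice D'.f, z = D'.c * w) ∧ q.Prime ∧ q ≠ 2 ∧ q ^ 2 ∣ N ∧
        IsIsogenous C W ∧ u • A.quadraticTwist (((-1 : ℤ) ^ (q / 2) * q : ℤ) : ℚ) = C ∧
        C.Δ = ((((-1 : ℤ) ^ (q / 2) * q : ℤ)) : ℚ) ^ 6 * A.Δ ∧
        A.minimalDiscriminantInt.natAbs < W.minimalDiscriminantInt.natAbs) →
      ¬ W.HasIrreducibleModPGaloisRep 2 → ¬ (2 : ℤ) ∣ D.c) :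
    Summit.BirchSwinnertonDyer.BirchSwinnertonDyer.Theses.ManinLocalTwoThree.ManinOddAtFour :=
  Summit.BirchSwinnertonDyer.BirchSwinnertonDyer.Theorems.maninLocalTwoThree_maninOddAtFour_of_orbitMinimalKatoShift_of_orbitMinimalResiduals
    (fun W _ _ _ _ D hopt h4 _ _ _ _ _ hirr =>
      katoShiftTwistManinTwo_of_realKatoFact_of_generation hF multiShiftClassGenerationTwo_holds W D hopt h4 hirr)
    (fun W _ _ _ _ D hopt h4 _ _ _ _ _ hirr _ _ =>
      katoManinOddTwo_of_realKatoFact_of_generation hF multiShiftClassGenerationTwo_holds W D hopt h4 hirr)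
    hRb

/-- **C2 `ManinOddAtFour` BY NAME from Kato's F♯ and the UNRESTRICTED reducible residual `ManinOddOfReducibleAtFour`.**
CONDITIONAL result. [cite: Kato2004Asterisque, Thm. 9.7 (p. 189)] -/
theorem maninOddAtFour_of_katoFact_of_reducible
    (hF : kato_neron_isIntegral_twistedSymbolSum_of_additive_two_real) (hRb : ManinOddOfReducibleAtFour) :
    Summit.BirchSwinnertonDyer.BirchSwinnertonDyer.Theses.ManinLocalTwoThree.ManinOddAtFour :=
  maninOddAtFour_of_realKatoFact_of_generation_of_reducible hF multiShiftClassGenerationTwo_holds hRb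

end Summit.BirchSwinnertonDyer.BirchSwinnertonDyer.Theorems.ManinLocalTwoThree

end
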